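import Summits.ABC.IUTFork.Repair.CandMochizuki7RamEResidual
import Summits.ABC.IUTFork.Repair.CandMochizuki7RamPins
import Summits.ABC.IUTFork.Cor312PinnedRegionsThreePins
import HarnessLib

/-!
# IUT REPAIR BRANCH (rung LADDER-ABC:A2.RP) — the frozen Θ-pin on the ramified bed RAM_e(p, m) of GENERAL index:
# UNSATISFIABLE for every region reading under the lattice-automorphism (Dupuy–Hilado) reading of Ism, every `e ≥ 2`, every `m`

Record file (D-0012; MODEL DATA `transNil`/`trans`/`shearE`/`gfamE`/`stabFamE`/`shearIdx` — an (Ind2)-family STABILISING the Θ-pilot's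
Kummer tuple —, then proofs; no `Prop` fact; nothing asserted about print; the adjudication-closure files `Cor312PinnedRegions` /
`Cor312PinnedRegionsThreePins` are IMPORTED, not edited — DEFS-FREEZE) of the abc-iut cell, seat abc-iut-rp-m1 (gen 5; class (ii) =
Mochizuki's replies). TAKES NO SIDE on [IUTchIII] Cor. 3.12 or on any author; typed ≠ proved. Sequel to `Repair/CandMochizuki7RamE` /
`…RamEResidual` (RAM_e(p, m): `K = ℚ_p(π)`, `π^e = p`, packet log-shell lattice `𝕀 = ⊗^{j+1} I`, Ism = `GL_e(ℤ_(p))` = ALL lattice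
automorphisms — the Dupuy–Hilado arXiv v1 §4.9 reading [cite: DupuyHilado2025, §4.9], declared STRONGER than print's [IUTchII] Ex. 1.8 (iv) —,
honest column `ramColumnE` with Θ-tuple `(π^{m·j²})_j`, q-datum `(π^m)_j`) and the general-`e` form of the seat's gen-3 file
`Repair/CandMochizuki7RamPins` (`e = 2`).

WHY. Gen 4's `ramEH_object_model` (`Repair/CandMochizuki7RamEResidual`) exhibits, for `e > 4m`, an honest bed on which the director's OBJECT
sentence `PilotKummerIndRelated` HOLDS for every region reading `ρ`, with the typed Corollary and the licence. The director's test (T-c)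
asks for satisfiability together with the Corollary's own pins `PinnedRegions3` (plan/ADJUDICATION-SPEC (G-PINNED-2)). This file settles the
Θ-pin on the whole RAM_e family: it is UNSATISFIABLE. The frozen `Cor312Vol.ThetaPinned S P ρ` has two clauses, (hρ) `ρ` is
⟨Ind1∪Ind2⟩-EQUIVARIANT on all data and (pΘ) `thetaRegion m = ρ(frobΨ m)`; together they force every indeterminacy FIXING the Θ-pilot's
Kummer datum to FIX its region (gen 3's `CandMochizuki7Ram.thetaRegion_stable_of_thetaPinned`, any index). On RAM_e the (Ind2)-family
`stabFamE` = «the transvection `π ↦ π + 1` (all other `π^i` fixed) on the FIRST tensor factor, identity elsewhere» FIXES the Θ-tuple — the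
honest elements `π^k = p^{⌊k/e⌋}·(1 ⊗ ⋯ ⊗ 1 ⊗ π^{k mod e})` have first factor `1` — but MOVES EVERY Θ-box `box k` at every nonzero label
(`stabFamE_moves_box`: `p^a·(π ⊗ 1 ⊗ ⋯ ⊗ π^c) ∈ box k`, `e·a + c = k − 1`, acquires the term `p^a·(1 ⊗ ⋯ ⊗ π^c)` of valuation `k − 1`).
KERNEL CELLS (`e ≥ 2`, every prime `p`, every `m`):
* **`not_thetaPinned_ramE` / `not_thetaPinned_ramEH` — for EVERY region reading `ρ`: `¬ ThetaPinned` on RAM_e(p, m) and on the honest-(b)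
  bed RAM_e^H(p, m)**; hence `not_pinnedRegions3_ramEH` (∀ ρ, qK), and the pinned schemata `GapA3` / `GapH3` hold VACUOUSLY
  (`gapH3_ramEH_vacuous`);
* **`ramEH_object_model_not_pinned`** — the packaged honest caveat: at `e > 4m ≥ 4` the OBJECT sentence holds for every `ρ` (gen 4) AND no
  `ρ` three-pins the bed — so `ramEH_object_model` is a model of «Thm 3.11 (ii)(b) ∧ residual ∧ Statement ∧ Licence», NOT of the director's
  T-c conjunction «… ∧ PinnedRegions3».
READING (neutral, about OUR typing, not about print): the (hρ) clause encodes «indeterminacies act on regions through their action on Kummer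
data» — exact for scalar / valuation-isometric (Ind2) (every bed of record before RAM; and the ISOMETRIC readings of the ramified shells,
sequel `Repair/CandMochizuki7RamEIsoPins`, where the pins ARE satisfiable and everything fails honestly), false for lattice shears. So on the
ramified toy the windows opened by the DH-sized Ism (gen 4: typed Corollary for `m ≤ e−1`, residual for `e > 4m`) live exactly where the
Corollary's own Θ-pin cannot be imposed. A toy; DH's Ism, not print's; no repair is claimed; nothing here bears on [IUTchIII] Cor. 3.12.
[claim: Mochizuki2012, status: disputed] [cite: ScholzeStix2018, §2.2 pp. 9–10]
-/

noncomputable section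

open Set

namespace Summit.ABC.IUTFork.Repair.CandMochizuki7RamE

open Thm311 Cor312 Cor312.Checks Cor312.IdentifiedNonVacuity Cor312Vol Cor312Vol.NaiveWitness Cor312Vol.PinnedWitness
  Cor312Vol.RamifiedEWitness Literature.IUT.LogThetaLattice
open Cor312Vol.RamifiedWitness (PLe IsPInt ple_zero isPInt_one fib eq_fib ple_ppow_iff)

variable (p e : ℕ)

/-! ## 1. Transvections of `ℚ^e = ⊕_{i<e} ℚ·π^i` and the stabilising (Ind2)-family -/

section Shear

variable {e}

/-- The nilpotent part `x ↦ x_b·π^a` of the transvection `π^b ↦ π^b + π^a`. [folklore] -/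
def transNil (a b : Fin e) : (Fin e → ℚ) →ₗ[ℚ] (Fin e → ℚ) :=
  (LinearMap.toSpanSingleton ℚ _ (Pi.single a 1)) ∘ₗ LinearMap.proj b

/-- `transNil a b x = x_b·π^a`. [folklore] -/
@[simp] theorem transNil_apply (a b : Fin e) (x : Fin e → ℚ) : transNil a b x = x b • Pi.single a (1 : ℚ) := rfl

/-- `transNil a b ∘ transNil a b = 0` for `a ≠ b`. [folklore] -/
theorem transNil_transNil {a b : Fin e} (hab : a ≠ b) (x : Fin e → ℚ) : transNil a b (transNil a b x) = 0 := by
  rw [transNil_apply, transNil_apply, Pi.smul_apply, Pi.single_eq_of_ne (Ne.symm hab), smul_eq_mul, mul_zero, zero_smul]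

/-- **The TRANSVECTION `trans a b`** (`a ≠ b`): `π^b ↦ π^b + π^a`, every other `π^i` fixed — the unipotent matrix `1 + E_{ab}`, a lattice
automorphism of `I` that is no `𝒪_K`-semi-linear isometry. [folklore] -/
def trans {a b : Fin e} (hab : a ≠ b) : (Fin e → ℚ) ≃ₗ[ℚ] (Fin e → ℚ) :=
  LinearEquiv.ofLinear (LinearMap.id + transNil a b) (LinearMap.id - transNil a b)
    (LinearMap.ext fun x => by
      simp only [LinearMap.comp_apply, LinearMap.add_apply, LinearMap.sub_apply, LinearMap.id_apply, map_sub, transNil_transNil hab]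
      abel)
    (LinearMap.ext fun x => by
      simp only [LinearMap.comp_apply, LinearMap.add_apply, LinearMap.sub_apply, LinearMap.id_apply, map_add, transNil_transNil hab]
      abel)

/-- `trans a b x = x + x_b·π^a`. [folklore] -/
theorem trans_apply {a b : Fin e} (hab : a ≠ b) (x : Fin e → ℚ) : trans hab x = x + x b • Pi.single a (1 : ℚ) := rfl

/-- `(trans a b)⁻¹ x = x − x_b·π^a`. [folklore] -/
theorem trans_symm_apply {a b : Fin e} (hab : a ≠ b) (x : Fin e → ℚ) : (trans hab).symm x = x - x b • Pi.single a (1 : ℚ) := rfl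

/-- Transvections are lattice automorphisms (elements of RAM_e's Ism). [folklore] -/
theorem trans_mem_latticeAuts [Fact p.Prime] {a b : Fin e} (hab : a ≠ b) : trans hab ∈ latticeAuts p e := fun x => by
  constructor
  · intro hx c
    rw [trans_apply, Pi.add_apply, Pi.smul_apply, smul_eq_mul]
    exact (hx c).add (IsPInt.mul' (hx b) (intVec_single p e a c))
  · intro hx c
    have h := hx c
    have hb : x b = (trans hab x) b := by
      rw [trans_apply, Pi.add_apply, Pi.smul_apply, Pi.single_eq_of_ne (Ne.symm hab), smul_eq_mul, mul_zero, add_zero]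
    have h2 : x c = (trans hab x) c + -(x b * (Pi.single a (1 : ℚ) : Fin e → ℚ) c) := by
      rw [trans_apply, Pi.add_apply, Pi.smul_apply, smul_eq_mul]; ring
    rw [h2, hb]
    exact (hx c).add ((IsPInt.mul' (hx b) (intVec_single p e a c)).neg)

/-- Matrix entries of a transvection: `(trans a b)(π^d)_c = [c = d] + [d = b]·[c = a]`. [folklore] -/
theorem ent_trans {a b : Fin e} (hab : a ≠ b) (c d : Fin e) :
    ent e (trans hab) c d = (if c = d then 1 else 0) + (if d = b then (if c = a then 1 else 0) else 0) := by
  unfold ent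
  rw [trans_apply, Pi.add_apply, Pi.smul_apply, Pi.single_apply, Pi.single_apply, Pi.single_apply, smul_eq_mul]
  by_cases hd : d = b
  · subst hd
    by_cases hc : c = a
    · subst hc; simp
    · simp [hc]
  · have hbd : b ≠ d := fun h => hd h.symm
    simp [hd, hbd]

/-- Matrix entries of the identity: `δ_{cd}`. [folklore] -/
theorem ent_refl (c d : Fin e) : ent e (LinearEquiv.refl ℚ (Fin e → ℚ)) c d = if c = d then 1 else 0 := by
  unfold ent; rw [LinearEquiv.refl_apply, Pi.single_apply]

end Shear

section Family

variable {e} [NeZero e] (he : 2 ≤ e)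

/-- The exponent index `1` (the uniformiser `π`), available once `e ≥ 2`. [folklore] -/
def oneIdx : Fin e := ⟨1, he⟩

/-- `π ≠ 1`. [folklore] -/
theorem zero_ne_oneIdx : (0 : Fin e) ≠ oneIdx he := fun h => by
  have := congrArg Fin.val h; simp [oneIdx] at this

/-- **The SHEAR `shearE`**: `π ↦ π + 1`, all other `π^i` fixed (`e ≥ 2`). [claim: Mochizuki2012, status: disputed] -/
def shearE : (Fin e → ℚ) ≃ₗ[ℚ] (Fin e → ℚ) := trans (zero_ne_oneIdx he)

/-- The per-factor family «`shearE` on the FIRST tensor factor, identity on the others». [claim: Mochizuki2012, status: disputed] -/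
def gfamE (j : toyIndex.Label) (vQ : toyIndex.VQ) : toyIndex.Caps j → toyIndex.Fibre vQ → ((Fin e → ℚ) ≃ₗ[ℚ] (Fin e → ℚ)) :=
  fun i _ => if (i : ℕ) = 0 then shearE he else LinearEquiv.refl ℚ _

/-- **The STABILISING FAMILY `stabFamE`**: the (Ind2)-family acting by `shearE` on the first tensor factor of every packet.
[claim: Mochizuki2012, status: disputed] -/
def stabFamE : (ramShellsE p e).PacketAut := fun j vQ =>
  (ramShellsE p e).factorwise j vQ fun i => (ramShellsE p e).summandwise vQ (gfamE he j vQ i)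

/-- `stabFamE` is an (Ind2)-family … [folklore] -/
theorem stabFamE_mem_Ind2Family [Fact p.Prime] : stabFamE p he ∈ (ramShellsE p e).Ind2Family := fun j vQ =>
  ⟨gfamE he j vQ, fun i v => by
    unfold gfamE; split_ifs
    · exact trans_mem_latticeAuts p _
    · exact refl_mem_latticeAuts p e, rfl⟩

/-- … hence lies in `⟨(Ind1) ∪ (Ind2)⟩`. [folklore] -/
theorem stabFamE_mem_closure [Fact p.Prime] : stabFamE p he ∈ indG p e :=
  Subgroup.subset_closure (Or.inr (stabFamE_mem_Ind2Family p he))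

omit [NeZero e] in
/-- **Matrix of a factorwise family in the tensor basis**: `(⊗_i g_i)(c·e_{ε'})_ε = c·Π_i (g_i)_{ε(i) ε'(i)}` (Kronecker product). [folklore] -/
theorem coord_factorwise_smul_tb (j : toyIndex.Label) (vQ : toyIndex.VQ)
    (g : toyIndex.Caps j → toyIndex.Fibre vQ → ((Fin e → ℚ) ≃ₗ[ℚ] (Fin e → ℚ))) (c : ℚ) (ε ε' : toyIndex.Caps j → Fin e) :
    coord p e j vQ (((ramShellsE p e).factorwise j vQ fun i => (ramShellsE p e).summandwise vQ (g i)) (c • tb p e j vQ ε')) ε =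
      c * ∏ i, ent e (g i (fib vQ)) (ε i) (ε' i) := by
  rw [map_smul, coord_smul, tb_apply]
  unfold LogShells.factorwise
  erw [PiTensorProduct.congr_tprod, coord_tprod]
  congr 1
  refine Finset.prod_congr rfl fun i _ => ?_
  have h : ((ramShellsE p e).summandwise vQ (g i) (b1 p e vQ (ε' i))) (fib vQ) = g i (fib vQ) (Pi.single (ε' i) 1) := by
    show g i (fib vQ) (b1 p e vQ (ε' i) (fib vQ)) = _
    rw [b1_apply]
  rw [h]
  rfl

/-- `stabFamE(c·e_{ε'})_ε = c·Π_i (g_i)_{ε(i) ε'(i)}`. [folklore] -/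
theorem coord_stabFamE_smul_tb (j : toyIndex.Label) (vQ : toyIndex.VQ) (c : ℚ) (ε ε' : toyIndex.Caps j → Fin e) :
    coord p e j vQ (stabFamE p he j vQ (c • tb p e j vQ ε')) ε = c * ∏ i, ent e (gfamE he j vQ i (fib vQ)) (ε i) (ε' i) :=
  coord_factorwise_smul_tb p j vQ _ c ε ε'

/-- The entries of `gfamE` against a column whose first-factor index is `0` (the vector `1`) are Kronecker deltas. [folklore] -/
theorem ent_gfamE_of_first_zero (j : toyIndex.Label) (vQ : toyIndex.VQ) (ε ε' : toyIndex.Caps j → Fin e) (h0 : ε' 0 = 0)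
    (i : toyIndex.Caps j) : ent e (gfamE he j vQ i (fib vQ)) (ε i) (ε' i) = if ε i = ε' i then 1 else 0 := by
  by_cases hi : (i : ℕ) = 0
  · have hi0 : i = 0 := Fin.ext hi
    subst hi0
    unfold gfamE
    rw [if_pos hi]
    unfold shearE
    rw [ent_trans, h0, if_neg (zero_ne_oneIdx he), add_zero]
  · unfold gfamE
    rw [if_neg hi, ent_refl]

/-- `stabFamE` FIXES every scaled basis monomial whose first factor is `1` (`ε'(0) = 0`). [folklore] -/
theorem stabFamE_smul_tb_of_first_zero (j : toyIndex.Label) (vQ : toyIndex.VQ) (c : ℚ) (ε' : toyIndex.Caps j → Fin e)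
    (h0 : ε' 0 = 0) : stabFamE p he j vQ (c • tb p e j vQ ε') = c • tb p e j vQ ε' := by
  refine (tb p e j vQ).ext_elem fun ε => ?_
  show coord p e j vQ _ ε = coord p e j vQ _ ε
  rw [coord_stabFamE_smul_tb, coord_smul, coord_tb]
  congr 1
  simp_rw [ent_gfamE_of_first_zero he j vQ ε ε' h0]
  rw [Finset.prod_boole]
  by_cases hε : ε' = ε
  · subst hε; simp
  · rw [if_neg hε, if_neg]
    intro hall
    exact hε (funext fun i => (hall i (Finset.mem_univ i)).symm)

/-- At a nonzero label the index `(1, …, 1, π^c)` has first factor `1`. [folklore] -/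
theorem lastIdx_zero {j : toyIndex.Label} (hj : j ≠ 0) (c : Fin e) : lastIdx e j c 0 = 0 := by
  unfold lastIdx
  rw [if_neg]
  intro h
  have h1 := congrArg Fin.val h
  simp only [Fin.val_zero, Fin.val_last] at h1
  exact hj (Fin.ext (by simpa using h1.symm))

/-- **`stabFamE` FIXES the honest Kummer element `π^k` at every nonzero label** (its tensor index has first factor `1`). [folklore] -/
theorem stabFamE_piEltE [Fact p.Prime] {j : toyIndex.Label} (hj : j ≠ 0) (vQ : toyIndex.VQ) (k : ℤ) :
    stabFamE p he j vQ (piEltE p e j vQ k) = piEltE p e j vQ k := by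
  unfold piEltE
  exact stabFamE_smul_tb_of_first_zero p he j vQ _ _ (lastIdx_zero hj _)

/-- **`stabFamE` FIXES the Θ-pilot's Kummer tuple** `(π^{m·j²})_j`. [folklore] -/
theorem starAut_stabFamE_thetaTupleE [Fact p.Prime] (m : ℕ) (v : toyIndex.V) :
    (ramShellsE p e).starAut (stabFamE p he) v (thetaTupleE p e m v) = thetaTupleE p e m v := by
  funext j
  exact stabFamE_piEltE p he j.2 (toyIndex.over v) _

/-- … and the q-pilot's `(π^m)_j` (every tuple of `π`-powers). [folklore] -/
theorem starAut_stabFamE_qTupleE [Fact p.Prime] (m : ℕ) (v : toyIndex.V) :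
    (ramShellsE p e).starAut (stabFamE p he) v (qTupleE p e m v) = qTupleE p e m v := by
  funext j
  exact stabFamE_piEltE p he j.2 (toyIndex.over v) _

/-- **The witness index `(π, 1, …, 1, π^c)`**: `π` on the first tensor factor, `π^c` on the last, `1` in between (label `j ≠ 0`, so first ≠ last).
[folklore] -/
def shearIdx (j : toyIndex.Label) (c : Fin e) : toyIndex.Caps j → Fin e := fun i => if (i : ℕ) = 0 then oneIdx he else lastIdx e j c i

/-- `wt (π, 1, …, 1, π^c) = 1 + c` at a nonzero label. [folklore] -/
theorem wt_shearIdx {j : toyIndex.Label} (hj : j ≠ 0) (c : Fin e) : wt e (shearIdx he j c) = 1 + (c : ℕ) := by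
  have h1 : wt e (shearIdx he j c) = ((shearIdx he j c 0 : Fin e) : ℕ) + ∑ i : Fin (j : ℕ), ((shearIdx he j c i.succ : Fin e) : ℕ) :=
    Fin.sum_univ_succ _
  have h2 : wt e (lastIdx e j c) = ((lastIdx e j c 0 : Fin e) : ℕ) + ∑ i : Fin (j : ℕ), ((lastIdx e j c i.succ : Fin e) : ℕ) :=
    Fin.sum_univ_succ _
  have h3 : ∀ i : Fin (j : ℕ), shearIdx he j c i.succ = lastIdx e j c i.succ := fun i => by
    unfold shearIdx; rw [if_neg]; exact fun h => by simp at h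
  have h4 : shearIdx he j c 0 = oneIdx he := by simp [shearIdx]
  rw [wt_lastIdx, lastIdx_zero hj] at h2
  simp_rw [h3] at h1
  rw [h1, h4]
  simp only [oneIdx, Fin.val_mk, Fin.val_zero] at h2 ⊢
  omega

variable [hp : Fact p.Prime]

/-- **`stabFamE` MOVES EVERY Θ-box `box k` at every nonzero label** (`e ≥ 2`): with `e·a + c = k − 1`, `0 ≤ c < e`, the point
`p^a·e_{(π,1,…,1,π^c)} ∈ box k` goes to `p^a·(e_{(π,1,…,π^c)} + e_{(1,…,1,π^c)}) ∉ box k` (the new term has valuation `k − 1`). [folklore] -/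
theorem stabFamE_moves_box {j : toyIndex.Label} (hj : j ≠ 0) (vQ : toyIndex.VQ) (k : ℤ) :
    ∃ x ∈ box p e j vQ k, stabFamE p he j vQ x ∉ box p e j vQ k := by
  set a : ℤ := (k - 1) / e with ha
  set c : Fin e := resFin e (k - 1) with hc
  have hce : (e : ℤ) * a + ((c : ℕ) : ℤ) = k - 1 := by
    rw [hc, resFin_val, ha]; exact Int.mul_ediv_add_emod _ _
  refine ⟨(p : ℚ) ^ a • tb p e j vQ (shearIdx he j c),
    (ppow_smul_tb_mem_box_iff _ _ _).2 (by rw [wt_shearIdx he hj]; push_cast; omega), fun hmem => ?_⟩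
  have h1 := hmem (lastIdx e j c)
  rw [coord_stabFamE_smul_tb, wt_lastIdx] at h1
  have hprod : ∏ i, ent e (gfamE he j vQ i (fib vQ)) (lastIdx e j c i) (shearIdx he j c i) = 1 := by
    refine Finset.prod_eq_one fun i _ => ?_
    by_cases hi : (i : ℕ) = 0
    · have hi0 : i = 0 := Fin.ext hi
      subst hi0
      unfold gfamE shearIdx shearE
      rw [if_pos hi, if_pos hi, ent_trans, lastIdx_zero hj, if_neg (zero_ne_oneIdx he), if_pos rfl, if_pos rfl, zero_add]
    · unfold gfamE shearIdx
      rw [if_neg hi, if_neg hi, ent_refl, if_pos rfl]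
  rw [hprod, mul_one] at h1
  rcases h1 with h1 | h1
  · exact absurd h1 (ppow_ne_zero p a)
  · rw [padicValRat_ppow] at h1
    omega

end Family

/-! ## 2. The frozen Θ-pin is unsatisfiable on RAM_e and on RAM_e^H (`e ≥ 2`) -/

section Pins

variable [NeZero e] [hp : Fact p.Prime] (he : 2 ≤ e) (m : ℕ)

include he

/-- **THE FROZEN Θ-PIN IS UNSATISFIABLE ON RAM_e(p, m), EVERY `m`, EVERY `e ≥ 2`, FOR EVERY REGION READING `ρ`**: `stabFamE` fixes the
column's Θ-tuple but moves the Θ-box `box m` at label `1`. [claim: Mochizuki2012, status: disputed] -/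
theorem not_thetaPinned_ramE
    (ρ : (∀ v : toyIndex.V, v ∈ toyIndex.Vbad → Set ((ramShellsE p e).StarPacket v)) →
      ∀ (j : toyIndex.Label) (vQ : toyIndex.VQ), Set ((ramShellsE p e).Packet j vQ)) :
    ¬ ThetaPinned (ramLatticeE p e m) (ramSettingLE p e m) ρ := fun h => by
  have h10 : (1 : toyIndex.Label) ≠ 0 := by decide
  have hstab := CandMochizuki7Ram.thetaRegion_stable_of_thetaPinned (ramLatticeE p e m) (ramSettingLE p e m) ρ h
    (stabFamE_mem_closure p he) 0
    (fun v _ => by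
      show (ramShellsE p e).starAut (stabFamE p he) v '' {thetaTupleE p e m v} = {thetaTupleE p e m v}
      rw [Set.image_singleton, starAut_stabFamE_thetaTupleE]) 1 ()
  have hreg : (ramSettingLE p e m).thetaRegion 0 1 () = box p e 1 () (m : ℤ) := by
    have := ramSettingE_thetaRegion p e m 0 1 ()
    have hj : jsq (1 : toyIndex.Label) = 1 := rfl
    rw [hj, mul_one] at this
    exact this
  rw [hreg] at hstab
  obtain ⟨x, hx, hx'⟩ := stabFamE_moves_box p he h10 () (m : ℤ)
  exact hx' (hstab ▸ Set.mem_image_of_mem _ hx)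

/-- **THE FROZEN Θ-PIN IS UNSATISFIABLE ON THE HONEST-(b) BED RAM_e^H(p, m)** (gen 4's OBJECT-model bed), every `m`, every `e ≥ 2`, for
every region reading `ρ` — same shear, same box. [claim: Mochizuki2012, status: disputed] -/
theorem not_thetaPinned_ramEH
    (ρ : (∀ v : toyIndex.V, v ∈ toyIndex.Vbad → Set ((ramShellsE p e).StarPacket v)) →
      ∀ (j : toyIndex.Label) (vQ : toyIndex.VQ), Set ((ramShellsE p e).Packet j vQ)) :
    ¬ ThetaPinned (ramLatticeEH p e m) (ramSettingEH p e m) ρ := fun h => by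
  have h10 : (1 : toyIndex.Label) ≠ 0 := by decide
  have hstab := CandMochizuki7Ram.thetaRegion_stable_of_thetaPinned (ramLatticeEH p e m) (ramSettingEH p e m) ρ h
    (stabFamE_mem_closure p he) 0
    (fun v _ => by
      show (ramShellsE p e).starAut (stabFamE p he) v '' {thetaTupleE p e m v} = {thetaTupleE p e m v}
      rw [Set.image_singleton, starAut_stabFamE_thetaTupleE]) 1 ()
  have hreg : (ramSettingEH p e m).thetaRegion 0 1 () = box p e 1 () (m : ℤ) := by
    have : (ramSettingEH p e m).thetaRegion 0 1 () = box p e 1 () ((m : ℤ) * jsq (1 : toyIndex.Label)) :=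
      ramSettingE_thetaRegion p e m 0 1 ()
    have hj : jsq (1 : toyIndex.Label) = 1 := rfl
    rw [hj, mul_one] at this
    exact this
  rw [hreg] at hstab
  obtain ⟨x, hx, hx'⟩ := stabFamE_moves_box p he h10 () (m : ℤ)
  exact hx' (hstab ▸ Set.mem_image_of_mem _ hx)

/-- Hence `¬ PinnedRegions` on RAM_e for every `ρ`, `qK` … [claim: Mochizuki2012, status: disputed] -/
theorem not_pinnedRegions_ramE
    (ρ : (∀ v : toyIndex.V, v ∈ toyIndex.Vbad → Set ((ramShellsE p e).StarPacket v)) →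
      ∀ (j : toyIndex.Label) (vQ : toyIndex.VQ), Set ((ramShellsE p e).Packet j vQ))
    (qK : ∀ v : toyIndex.V, v ∈ toyIndex.Vbad → Set ((ramShellsE p e).StarPacket v)) :
    ¬ PinnedRegions (ramLatticeE p e m) (ramSettingLE p e m) ρ qK := fun h => not_thetaPinned_ramE p e he m ρ h.1

/-- … and `¬ PinnedRegions3` on RAM_e^H for every `ρ`, `qK` (whatever the link pin). [claim: Mochizuki2012, status: disputed] -/
theorem not_pinnedRegions3_ramEH
    (ρ : (∀ v : toyIndex.V, v ∈ toyIndex.Vbad → Set ((ramShellsE p e).StarPacket v)) →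
      ∀ (j : toyIndex.Label) (vQ : toyIndex.VQ), Set ((ramShellsE p e).Packet j vQ))
    (qK : ∀ v : toyIndex.V, v ∈ toyIndex.Vbad → Set ((ramShellsE p e).StarPacket v)) :
    ¬ PinnedRegions3 (ramLatticeEH p e m) (ramSettingEH p e m) ρ qK := fun h => not_thetaPinned_ramEH p e he m ρ h.1.1

/-- … so the three-pin schema `GapH3` holds VACUOUSLY on RAM_e^H (the bed does not engage pinned-schema rows). [claim: Mochizuki2012, status: disputed] -/
theorem gapH3_ramEH_vacuous
    (ρ : (∀ v : toyIndex.V, v ∈ toyIndex.Vbad → Set ((ramShellsE p e).StarPacket v)) →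
      ∀ (j : toyIndex.Label) (vQ : toyIndex.VQ), Set ((ramShellsE p e).Packet j vQ))
    (qK : ∀ v : toyIndex.V, v ∈ toyIndex.Vbad → Set ((ramShellsE p e).StarPacket v)) :
    GapH3 (ramLatticeEH p e m) (ramSettingEH p e m) ρ qK :=
  gapH3_of_not_pinned3 (ramLatticeEH p e m) (ramSettingEH p e m) ρ qK (not_pinnedRegions3_ramEH p e he m ρ qK)

/-- **THE HONEST CAVEAT ON GEN 4's OBJECT-MODEL, PACKAGED** (`e > 4m ≥ 4`): on RAM_e^H(p, m) Thm. 3.11 (ii) (b) holds, the OBJECT sentence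
`PilotKummerIndRelated` holds for EVERY region reading together with the typed Corollary and the licence (gen 4, `ramEH_object_model`) —
AND NO region reading three-pins the bed (`¬ PinnedRegions3` for every `ρ`). So the bed models «(ii)(b) ∧ residual ∧ Statement ∧ Licence»,
not the director's T-c conjunction «… ∧ PinnedRegions3». [claim: Mochizuki2012, status: disputed] -/
theorem ramEH_object_model_not_pinned (hm : 1 ≤ m) (h : 4 * m < e)
    (ρ : (∀ v : toyIndex.V, v ∈ toyIndex.Vbad → Set ((ramShellsE p e).StarPacket v)) →
      ∀ (j : toyIndex.Label) (vQ : toyIndex.VQ), Set ((ramShellsE p e).Packet j vQ)) :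
    (((ramLatticeEH p e m).col (ramSettingEH p e m).n).KummerB ((ramLatticeEH p e m).D (ramSettingEH p e m).n) ∧
        PilotKummerIndRelated (ramLatticeEH p e m) (ramSettingEH p e m) ρ (qDatumE p e m) ∧
        (ramSettingEH p e m).Statement ∧ Thm311ToCor312.Licence (ramSettingEH p e m)) ∧
      ∀ qK, ¬ PinnedRegions3 (ramLatticeEH p e m) (ramSettingEH p e m) ρ qK :=
  have hmod := ramEH_object_model p e m hm h ρ
  ⟨⟨hmod.1, hmod.2.2.2.1, hmod.2.2.2.2⟩, fun qK => not_pinnedRegions3_ramEH p e (by omega) m ρ qK⟩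

end Pins

end Summit.ABC.IUTFork.Repair.CandMochizuki7RamE

end
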